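import Mathlib
import Literature.Analysis.FluidPDE.VectorCalculus
import Summits.NavierStokesRegularity.NavierStokesRegularity.Theorems.FilamentSkeletonRssClause13RPairwiseAdjoint
import Summits.NavierStokesRegularity.NavierStokesRegularity.Theorems.FilamentSkeletonRssClause13RStationContinuity

/-!
# Clause 13-R, route (ii′) item (a), part 4: the INTEGRATED PAIR IDENTITY — one filament pair `(j, k)`, paired over the ball `S_j`
# (crux `Clause13RNearStraightL`, stmt-NavierStokesRegularity-23612; line `rate_bordered_split`, STUB R `stub_rateRow13RFlat`)

Route `FilamentSkeletonRss`, Variant A1R.  Combining `…Clause13RPairwiseAdjoint` (split, local transposition, Fubini for the `Y`-piece, by-parts for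
the `Y′`-piece) with `…Clause13RStationContinuity` (integrability of the three pairing densities on a compact ball) gives, for ONE pair of filaments
and a continuous weight `φ` on the ball `S` (`y = X_j|_S` the stations, `Y_J = Y_j` the own test field, `X = X_k`, `Y = Y_k`, core `m = κ·Aa_k` with floor
`m₀` and equal to `a₀` on an open `U ⊇ tsupport Y_k`):

`∫_{S} ⟪φτ, ∫ I_{jk}(τ, σ) dσ⟫ dτ = ∫_{S} ⟪A(τ), Y_J τ⟫ dτ + ∫ ⟪B(σ), Y σ⟫ dσ − ∫ ⟪C(σ), Y σ⟫ dσ`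

with the EXPLICIT adjoint weights
`A(τ) = ∫ [(−3K₅⟪φτ, X′σ × (yτ − Xσ)⟫)•(yτ − Xσ) + K₃•(φτ × X′σ)] dσ` (local),
`B(σ) = ∫_{S} [(3K₅⟪φτ, X′σ × (yτ − Xσ)⟫)•(yτ − Xσ) − K₃•(φτ × X′σ)] dτ` (nonlocal),
`C(σ) = ∫_{S} [(3⟪yτ − Xσ, X′σ⟫((‖yτ − Xσ‖² + a₀)^{5/2})⁻¹)•(φτ × (Xσ − yτ)) + ((‖yτ − Xσ‖² + a₀)^{3/2})⁻¹•(φτ × X′σ)] dτ` (from `Y′`)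
(`setIntegral_inner_integral_variation_eq`).  Summing over `k` with the circulation weights `Γγ_k/4π`, adding the local terms `½Y_j − α e₃ × Y_j` and the
slip term (`…Clause13RSlipAdjoint`), and summing over `j` is the remaining bookkeeping of census item (a) (memo STRUCTURE-23612-conformal-cokernel-leafhand8-g1.md).

Hand `leafhand-ns-filamentskeletonrs-10-g0` (LAND-ONLY); `--supports stmt-NavierStokesRegularity-23612` helper.  HONEST FRAMING: calculus at a HYPOTHETICAL
near-straight filament skeleton on the NEGATIVE side of a MODEL blow-up route; STUB R is NOT proved here and nothing in this file bears on Navier–Stokes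
regularity or blow-up.
-/

noncomputable section

open MeasureTheory Filter Topology Set
open scoped RealInnerProductSpace InnerProductSpace
open Literature.Analysis.FluidPDE
open Summit.NavierStokesRegularity.NavierStokesRegularity.Theorems.Clause13RPairwiseAdjoint
open Summit.NavierStokesRegularity.NavierStokesRegularity.Theorems.Clause13RStationContinuity

namespace Summit.NavierStokesRegularity.NavierStokesRegularity.Theorems.Clause13RPairIntegrated
set_option linter.dupNamespace false

/-- **THE INTEGRATED PAIR IDENTITY** (see the module docstring for the names `A, B, C`). [folklore] -/
theorem setIntegral_inner_integral_variation_eq {S U : Set ℝ} (hS : IsCompact S) (hU : IsOpen U)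
    {y φ YJ X Y : ℝ → EuclideanSpace ℝ (Fin 3)} {m : ℝ → ℝ} {m₀ c C R a₀ : ℝ}
    (hy : Continuous y) (hφ : Continuous φ) (hYJ : Continuous YJ) (hyS : ∀ τ ∈ S, ‖y τ‖ ≤ R)
    (hm₀ : 0 < m₀) (hm : ∀ σ, m₀ ≤ m σ) (hmc : Continuous m) (ha₀ : 0 < a₀) (hmU : ∀ σ ∈ U, m σ = a₀)
    (hc : 0 < c) (hX : ContDiff ℝ 1 X) (hX1 : ∀ σ, ‖deriv X σ‖ ≤ 1) (hXg : ∀ σ, c * |σ| - C ≤ ‖X σ‖)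
    (hY : ContDiff ℝ 1 Y) (hYc : HasCompactSupport Y) (hYU : tsupport Y ⊆ U) :
    ∫ τ in S, ⟪φ τ, ∫ σ, ((-3 * ⟪y τ - X σ, YJ τ - Y σ⟫ * ((‖y τ - X σ‖ ^ 2 + m σ) ^ (5 / 2 : ℝ))⁻¹) • cross (deriv X σ) (y τ - X σ)
        + ((‖y τ - X σ‖ ^ 2 + m σ) ^ (3 / 2 : ℝ))⁻¹ • (cross (deriv X σ) (YJ τ - Y σ) + cross (deriv Y σ) (y τ - X σ)))⟫
      = (∫ τ in S, ⟪∫ σ, ((-3 * ((‖y τ - X σ‖ ^ 2 + m σ) ^ (5 / 2 : ℝ))⁻¹ * ⟪φ τ, cross (deriv X σ) (y τ - X σ)⟫) • (y τ - X σ)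
            + ((‖y τ - X σ‖ ^ 2 + m σ) ^ (3 / 2 : ℝ))⁻¹ • cross (φ τ) (deriv X σ)), YJ τ⟫)
        + (∫ σ, ⟪∫ τ in S, ((3 * ((‖y τ - X σ‖ ^ 2 + m σ) ^ (5 / 2 : ℝ))⁻¹ * ⟪φ τ, cross (deriv X σ) (y τ - X σ)⟫) • (y τ - X σ)
            - ((‖y τ - X σ‖ ^ 2 + m σ) ^ (3 / 2 : ℝ))⁻¹ • cross (φ τ) (deriv X σ)), Y σ⟫)
        - ∫ σ, ⟪∫ τ in S, ((3 * ⟪y τ - X σ, deriv X σ⟫ * ((‖y τ - X σ‖ ^ 2 + a₀) ^ (5 / 2 : ℝ))⁻¹) • cross (φ τ) (X σ - y τ)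
            + ((‖y τ - X σ‖ ^ 2 + a₀) ^ (3 / 2 : ℝ))⁻¹ • cross (φ τ) (deriv X σ)), Y σ⟫ := by
  have hmpos : ∀ σ, 0 < m σ := fun σ => hm₀.trans_le (hm σ)
  have hYcont : Continuous Y := hY.continuous
  -- Step 1: pointwise in `τ`: split the `σ`-integral and transpose the local part
  have hptw : ∀ τ, ⟪φ τ, ∫ σ, ((-3 * ⟪y τ - X σ, YJ τ - Y σ⟫ * ((‖y τ - X σ‖ ^ 2 + m σ) ^ (5 / 2 : ℝ))⁻¹) • cross (deriv X σ) (y τ - X σ)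
        + ((‖y τ - X σ‖ ^ 2 + m σ) ^ (3 / 2 : ℝ))⁻¹ • (cross (deriv X σ) (YJ τ - Y σ) + cross (deriv Y σ) (y τ - X σ)))⟫
      = ⟪∫ σ, ((-3 * ((‖y τ - X σ‖ ^ 2 + m σ) ^ (5 / 2 : ℝ))⁻¹ * ⟪φ τ, cross (deriv X σ) (y τ - X σ)⟫) • (y τ - X σ)
            + ((‖y τ - X σ‖ ^ 2 + m σ) ^ (3 / 2 : ℝ))⁻¹ • cross (φ τ) (deriv X σ)), YJ τ⟫
        + ⟪φ τ, ∫ σ, ((3 * ⟪y τ - X σ, Y σ⟫ * ((‖y τ - X σ‖ ^ 2 + m σ) ^ (5 / 2 : ℝ))⁻¹) • cross (deriv X σ) (y τ - X σ)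
            - ((‖y τ - X σ‖ ^ 2 + m σ) ^ (3 / 2 : ℝ))⁻¹ • cross (deriv X σ) (Y σ))⟫
        + ⟪φ τ, ∫ σ, ((‖y τ - X σ‖ ^ 2 + m σ) ^ (3 / 2 : ℝ))⁻¹ • cross (deriv Y σ) (y τ - X σ)⟫ := by
    intro τ
    rw [integral_variation_split (y τ) (YJ τ) hm₀ hm hmc hc hX hX1 hXg hY hYc, inner_add_right, inner_add_right,
      inner_integral_local_eq (φ τ) (y τ) (YJ τ) hm₀ hm hmc hc hX hX1 hXg]
  rw [integral_congr_ae (μ := volume.restrict S) (Eventually.of_forall fun τ => hptw τ)]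
  -- Step 2: linearity over `S` (the three densities are integrable on the compact ball)
  have i1 := integrableOn_inner_localAdj (φ := φ) (Y := YJ) hS hm₀ hm hmc hc hX hX1 hXg hy hφ hYJ hyS
  have i2 := integrableOn_inner_integral_nonlocal (φ := φ) hS hmc hmpos hX hy hφ hYcont hYc
  have i3 := integrableOn_inner_integral_derivTerm (φ := φ) hS hmc hmpos hX hy hφ hY hYc
  have i12 : IntegrableOn (fun τ =>
      ⟪∫ σ, ((-3 * ((‖y τ - X σ‖ ^ 2 + m σ) ^ (5 / 2 : ℝ))⁻¹ * ⟪φ τ, cross (deriv X σ) (y τ - X σ)⟫) • (y τ - X σ)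
            + ((‖y τ - X σ‖ ^ 2 + m σ) ^ (3 / 2 : ℝ))⁻¹ • cross (φ τ) (deriv X σ)), YJ τ⟫
        + ⟪φ τ, ∫ σ, ((3 * ⟪y τ - X σ, Y σ⟫ * ((‖y τ - X σ‖ ^ 2 + m σ) ^ (5 / 2 : ℝ))⁻¹) • cross (deriv X σ) (y τ - X σ)
            - ((‖y τ - X σ‖ ^ 2 + m σ) ^ (3 / 2 : ℝ))⁻¹ • cross (deriv X σ) (Y σ))⟫) S := i1.add i2
  rw [integral_add i12 i3, integral_add i1 i2]
  -- Step 3: the nonlocal pieces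
  rw [setIntegral_inner_integral_nonlocal_eq hS hφ hy hX hmc hmpos hYcont hYc,
    setIntegral_inner_integral_derivTerm_eq hS hφ hy hX hmc hmpos ha₀ hU hmU hY hYc hYU]
  ring

end Summit.NavierStokesRegularity.NavierStokesRegularity.Theorems.Clause13RPairIntegrated

end
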